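import Summits.CriticalPhenomena.PercolationContinuityZ3.Theorems.PercNearOneGluingNoHeavyPcintNawChainMemSym
import Summits.CriticalPhenomena.PercolationContinuityZ3.Theorems.PercNearOneGluingNoHeavyPcintNawRandMemKernelCert
import HarnessLib

/-!
# PCINT lane, reduction B2c on the dangerous-set automaton — kernel mirrors of the chain data

Cell `prim-pcint` (PAPER-2 track (iii)), seat `prim-pcint-1` (gen 5); support file (`--supports stmt-CriticalPhenomena-4575`).
Does NOT build on p205010.  Memo: run/shared/lean/prim/pcint/REDUCTIONS.md §B2c (prim-pcint-2 gen 3), §B2c.7 (reduced states).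

`decide +kernel`-evaluable mirrors of the chain rule on `NawK.KState` (integer-list states of `…PcintNawRandMemKernel`):
`NawK.cnbrL/visK/cactiveK/cuncondK/bonusWitK/cbonusK/ccornerK/cpayK/cuK/ccK`, with the bridges `cactiveK_eq`, `cuncondK_eq`,
`cbonusK_eq`, `ccornerK_eq`, `cpayK_eq`, **`cuK_eq`/`ccK_eq`** (`= cu/cc (toM L)` for well-formed `L`) and the bounds `cuK_le`/`ccK_le`
(`≤ 4d`).
-/

namespace Summit.CriticalPhenomena.PercolationContinuityZ3.Theorems.Pcint

open Finset Literature.Probability.Percolation Literature.Probability.LatticeModels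

/-! ## Kernel layer for the chain rule (`NawK` namespace, on top of `…PcintNawRandMemKernel`) -/

namespace NawK

open WinK (toSite toL addL adjL toSite_addL toSite_toL adj_iff_adjL toSite_inj length_toL length_addL toSite_zeroL zeroL)

variable {d : ℕ}

/-! ### Kernel mirrors of the chain data -/

/-- The neighbour vector of the new vertex in direction `b`, as an integer list. [folklore] -/
def cnbrL (d : ℕ) (a b : Fin d × Bool) : List ℤ := addL (toL d a) (toL d b)

/-- Kernel visible incidences: the remembered entries adjacent to the neighbour. [folklore] -/
def visK (d : ℕ) (L : KState) (a b : Fin d × Bool) : KState := L.filter fun x => adjL d x.1 (cnbrL d a b)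

/-- Kernel `cactive`. [folklore] -/
def cactiveK (d kc : ℕ) (L : KState) (a b : Fin d × Bool) : Bool :=
  !decide (cnbrL d a b = zeroL d) && (visK d L a b).any fun x => decide (x.2 + 1 ≤ kc)

/-- Kernel `cuncond`. [folklore] -/
def cuncondK (d : ℕ) (L : KState) (a b : Fin d × Bool) : Bool := (visK d L a b).any fun x => decide (3 ≤ x.2)

/-- Kernel bonus witness test (for an entry of `visK`). [folklore] -/
def bonusWitK (τ kc d : ℕ) (L : KState) (a b : Fin d × Bool) (x₁ : List ℤ × ℕ) : Bool :=
  decide (x₁.2 + kc + 3 ≤ τ) && (visK d L a b).all fun x => (x.2 == x₁.2) || decide (x₁.2 + kc < x.2)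

/-- Kernel `cbonus`. [folklore] -/
def cbonusK (τ kc d : ℕ) (L : KState) (a b : Fin d × Bool) : Bool := (visK d L a b).any fun x₁ => bonusWitK τ kc d L a b x₁

/-- Kernel `ccorner`. [folklore] -/
def ccornerK (d : ℕ) (L : KState) (b : Fin d × Bool) : Bool := L.any fun x => decide (x.1 = toL d b) && (x.2 == 1)

/-- Kernel `cpay`. [folklore] -/
def cpayK (τ kc d : ℕ) (L : KState) (a b : Fin d × Bool) : ℕ :=
  if cactiveK d kc L a b then (if cbonusK τ kc d L a b then 2 else 1) else 0

/-- Kernel `cu`. [folklore] -/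
def cuK (τ kc d : ℕ) (L : KState) (a : Fin d × Bool) : ℕ :=
  ((letters d).map fun b => if cuncondK d L a b then cpayK τ kc d L a b else 0).sum

/-- Kernel `cc`. [folklore] -/
def ccK (τ kc d : ℕ) (L : KState) (a : Fin d × Bool) : ℕ :=
  ((letters d).map fun b => if !cuncondK d L a b && ccornerK d L b then cpayK τ kc d L a b else 0).sum

/-! ### Bridges -/

/-- The kernel neighbour vector denotes `cnbr`. [folklore] -/
theorem toSite_cnbrL (a b : Fin d × Bool) : (toSite (cnbrL d a b) : Site d) = cnbr a b := by
  rw [cnbrL, toSite_addL (length_toL a) (length_toL b), toSite_toL, toSite_toL]; rfl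

/-- Length of the kernel neighbour vector. [folklore] -/
theorem length_cnbrL (a b : Fin d × Bool) : (cnbrL d a b).length = d := length_addL (length_toL a) (length_toL b)

/-- Membership in the kernel visible incidences. [folklore] -/
theorem mem_visK {L : KState} (hL : WF d L = true) {a b : Fin d × Bool} {x : List ℤ × ℕ} :
    x ∈ visK d L a b ↔ x ∈ L ∧ ((toSite x.1 : Site d), x.2) ∈ cvis (toM L : MState d) a b := by
  rw [visK, List.mem_filter]
  constructor
  · rintro ⟨hx, hadj⟩
    refine ⟨hx, mem_cvis.2 ⟨mem_toM.2 ⟨x, hx, rfl⟩, ?_⟩⟩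
    rw [← toSite_cnbrL]; exact (adj_iff_adjL (length_of_WF hL hx) (length_cnbrL a b)).2 hadj
  · rintro ⟨hx, hq⟩
    refine ⟨hx, ?_⟩
    have := (mem_cvis.1 hq).2
    rw [← toSite_cnbrL] at this
    exact (adj_iff_adjL (length_of_WF hL hx) (length_cnbrL a b)).1 this

/-- Every visible incidence of the denoted state comes from a kernel visible incidence. [folklore] -/
theorem exists_visK_of_mem_cvis {L : KState} (hL : WF d L = true) {a b : Fin d × Bool} {q : Site d × ℕ}
    (hq : q ∈ cvis (toM L : MState d) a b) : ∃ x ∈ visK d L a b, ((toSite x.1 : Site d), x.2) = q := by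
  obtain ⟨hqS, hadj⟩ := mem_cvis.1 hq
  obtain ⟨x, hx, rfl⟩ := mem_toM.1 hqS
  exact ⟨x, (mem_visK hL).2 ⟨hx, hq⟩, rfl⟩

/-- Existential properties of visible ages agree. [folklore] -/
theorem any_visK_iff {L : KState} (hL : WF d L = true) {a b : Fin d × Bool} (P : ℕ → Prop) [DecidablePred P] :
    ((visK d L a b).any fun x => decide (P x.2)) = true ↔ ∃ q ∈ cvis (toM L : MState d) a b, P q.2 := by
  rw [List.any_eq_true]
  constructor
  · rintro ⟨x, hx, hP⟩
    exact ⟨_, ((mem_visK hL).1 hx).2, of_decide_eq_true hP⟩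
  · rintro ⟨q, hq, hP⟩
    obtain ⟨x, hx, rfl⟩ := exists_visK_of_mem_cvis hL hq
    exact ⟨x, hx, decide_eq_true hP⟩

/-- Universal properties of visible ages agree. [folklore] -/
theorem all_visK_iff {L : KState} (hL : WF d L = true) {a b : Fin d × Bool} (P : ℕ → Prop) [DecidablePred P] :
    ((visK d L a b).all fun x => decide (P x.2)) = true ↔ ∀ q ∈ cvis (toM L : MState d) a b, P q.2 := by
  rw [List.all_eq_true]
  constructor
  · intro h q hq
    obtain ⟨x, hx, rfl⟩ := exists_visK_of_mem_cvis hL hq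
    exact of_decide_eq_true (h x hx)
  · intro h x hx
    exact decide_eq_true (h _ ((mem_visK hL).1 hx).2)

/-- `cactiveK` computes `cactive`. [folklore] -/
theorem cactiveK_eq {kc : ℕ} {L : KState} (hL : WF d L = true) (a b : Fin d × Bool) :
    cactiveK d kc L a b = cactive kc (toM L : MState d) a b := by
  rw [Bool.eq_iff_iff, cactiveK, Bool.and_eq_true, cactive_iff, any_visK_iff hL (fun j => j + 1 ≤ kc)]
  have h0 : (!decide (cnbrL d a b = zeroL d)) = true ↔ cnbr a b ≠ (0 : Site d) := by
    rw [Bool.not_eq_true', decide_eq_false_iff_not, not_iff_not]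
    constructor
    · intro h; rw [← toSite_cnbrL, h, toSite_zeroL]
    · intro h; exact toSite_inj (length_cnbrL a b) WinK.length_zeroL (by rw [toSite_cnbrL, toSite_zeroL, h])
  rw [h0]

/-- `cuncondK` computes `cuncond`. [folklore] -/
theorem cuncondK_eq {L : KState} (hL : WF d L = true) (a b : Fin d × Bool) :
    cuncondK d L a b = cuncond (toM L : MState d) a b := by
  rw [Bool.eq_iff_iff, cuncondK, cuncond_iff, any_visK_iff hL (fun j => 3 ≤ j)]

/-- `bonusWitK` computes `bonusWit` on kernel visible incidences. [folklore] -/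
theorem bonusWitK_eq {τ kc : ℕ} {L : KState} (hL : WF d L = true) (a b : Fin d × Bool) {x₁ : List ℤ × ℕ}
    (hx₁ : x₁ ∈ visK d L a b) :
    bonusWitK τ kc d L a b x₁ = bonusWit τ kc (toM L : MState d) a b (toSite x₁.1, x₁.2) := by
  rw [Bool.eq_iff_iff, bonusWitK, Bool.and_eq_true, decide_eq_true_iff, bonusWit_iff]
  have hall : ((visK d L a b).all fun x => (x.2 == x₁.2) || decide (x₁.2 + kc < x.2)) =
      (visK d L a b).all fun x => decide (x.2 = x₁.2 ∨ x₁.2 + kc < x.2) := by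
    congr 1; funext x
    by_cases h1 : x.2 = x₁.2 <;> by_cases h2 : x₁.2 + kc < x.2 <;> simp [h1, h2]
  rw [hall, all_visK_iff hL (fun j => j = x₁.2 ∨ x₁.2 + kc < j)]
  have hmem := ((mem_visK hL).1 hx₁).2
  constructor
  · rintro ⟨h1, h2⟩; exact ⟨hmem, h1, h2⟩
  · rintro ⟨-, h1, h2⟩; exact ⟨h1, h2⟩

/-- `cbonusK` computes `cbonus`. [folklore] -/
theorem cbonusK_eq {τ kc : ℕ} {L : KState} (hL : WF d L = true) (a b : Fin d × Bool) :
    cbonusK τ kc d L a b = cbonus τ kc (toM L : MState d) a b := by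
  rw [Bool.eq_iff_iff, cbonusK, List.any_eq_true, cbonus_iff]
  constructor
  · rintro ⟨x₁, hx₁, h⟩
    exact ⟨_, by rwa [bonusWitK_eq hL a b hx₁] at h⟩
  · rintro ⟨q₁, hq₁⟩
    have hq₁v := ((bonusWit_iff τ kc).1 hq₁).1
    obtain ⟨x₁, hx₁, rfl⟩ := exists_visK_of_mem_cvis hL hq₁v
    exact ⟨x₁, hx₁, by rwa [bonusWitK_eq hL a b hx₁]⟩

/-- `ccornerK` computes `ccorner`. [folklore] -/
theorem ccornerK_eq {L : KState} (hL : WF d L = true) (b : Fin d × Bool) : ccornerK d L b = ccorner (toM L : MState d) b := by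
  rw [Bool.eq_iff_iff, ccornerK, List.any_eq_true, ccorner_iff, mem_toM]
  constructor
  · rintro ⟨x, hx, h⟩
    simp only [Bool.and_eq_true, decide_eq_true_eq, beq_iff_eq] at h
    refine ⟨x, hx, ?_⟩
    rw [h.1, toSite_toL, h.2]
  · rintro ⟨x, hx, hxq⟩
    simp only [Prod.mk.injEq] at hxq
    refine ⟨x, hx, ?_⟩
    simp only [Bool.and_eq_true, decide_eq_true_eq, beq_iff_eq]
    exact ⟨toSite_inj (length_of_WF hL hx) (length_toL b) (by rw [toSite_toL, hxq.1]), hxq.2⟩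

/-- `cpayK` computes `cpay`. [folklore] -/
theorem cpayK_eq {τ kc : ℕ} {L : KState} (hL : WF d L = true) (a b : Fin d × Bool) :
    cpayK τ kc d L a b = cpay τ kc (toM L : MState d) a b := by
  unfold cpayK cpay; rw [cactiveK_eq hL, cbonusK_eq hL]

/-- `cuK` computes `cu`. [folklore] -/
theorem cuK_eq {τ kc : ℕ} {L : KState} (hL : WF d L = true) (a : Fin d × Bool) : cuK τ kc d L a = cu τ kc (toM L : MState d) a := by
  unfold cuK cu
  rw [sum_letters_eq]
  refine Finset.sum_congr rfl fun b _ => ?_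
  rw [cuncondK_eq hL, cpayK_eq hL]

/-- `ccK` computes `cc`. [folklore] -/
theorem ccK_eq {τ kc : ℕ} {L : KState} (hL : WF d L = true) (a : Fin d × Bool) : ccK τ kc d L a = cc τ kc (toM L : MState d) a := by
  unfold ccK cc
  rw [sum_letters_eq]
  refine Finset.sum_congr rfl fun b _ => ?_
  rw [cuncondK_eq hL, ccornerK_eq hL, cpayK_eq hL]

/-- `cpayK ≤ 2`. [folklore] -/
theorem cpayK_le {τ kc : ℕ} (L : KState) (a b : Fin d × Bool) : cpayK τ kc d L a b ≤ 2 := by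
  unfold cpayK; split_ifs <;> omega

/-- `cuK ≤ 4d`. [folklore] -/
theorem cuK_le {τ kc : ℕ} (L : KState) (a : Fin d × Bool) : cuK τ kc d L a ≤ 4 * d := by
  unfold cuK
  have : ∀ b ∈ letters d, (fun b => if cuncondK d L a b then cpayK τ kc d L a b else 0) b ≤ 2 := fun b _ => by
    simp only; split_ifs
    · exact cpayK_le L a b
    · exact Nat.zero_le _
  calc ((letters d).map fun b => if cuncondK d L a b then cpayK τ kc d L a b else 0).sum
      ≤ ((letters d).map fun _ => 2).sum := List.sum_le_sum (fun b hb => this b hb)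
    _ = 4 * d := by rw [List.map_const', List.sum_replicate, length_letters]; ring

/-- `ccK ≤ 4d`. [folklore] -/
theorem ccK_le {τ kc : ℕ} (L : KState) (a : Fin d × Bool) : ccK τ kc d L a ≤ 4 * d := by
  unfold ccK
  have : ∀ b ∈ letters d, (fun b => if !cuncondK d L a b && ccornerK d L b then cpayK τ kc d L a b else 0) b ≤ 2 :=
    fun b _ => by
      simp only; split_ifs
      · exact cpayK_le L a b
      · exact Nat.zero_le _
  calc ((letters d).map fun b => if !cuncondK d L a b && ccornerK d L b then cpayK τ kc d L a b else 0).sum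
      ≤ ((letters d).map fun _ => 2).sum := List.sum_le_sum (fun b hb => this b hb)
    _ = 4 * d := by rw [List.map_const', List.sum_replicate, length_letters]; ring

end NawK

end Summit.CriticalPhenomena.PercolationContinuityZ3.Theorems.Pcint
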